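import Literature.Barriers.AnomalousDissipation.GravestModeLaminarAttractor
import Literature.Analysis.FluidPDE.NSEnstrophyBalance2DProofs
import Literature.Analysis.FluidPDE.NSEnergyEquality2D
import Literature.Analysis.FluidPDE.LerayHopfUniformEnergyMomentum
import Literature.Analysis.FluidPDE.SteadyNavierStokesProofs
import Literature.Analysis.FluidPDE.NSStokesTruncation2D
import Literature.Analysis.FluidPDE.TimeAverageEnstrophy
import Literature.Analysis.FunctionSpaces.TorusWeightedGalerkinCoefficients
import HarnessLib

/-!
# Tran–Shepherd's dynamical constraint for single-shell forcing, at the Leray–Hopf level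
(barrier-audit proof file next to `Literature/Barriers/AnomalousDissipation/GravestModeLaminarAttractor`,
audit generation 6; Leray–Hopf companion of the Galerkin-level
`GravestModeLaminarAttractorShellPincer`)

For a steady force `g` on `𝕋²` valued in ONE eigenspace of the Stokes operator — Fourier
support on a single shell `|k|² = m`, eigenvalue `λ = 4π²m` — the enstrophy and energy balances
of the 2-D Navier–Stokes equations combine: `(g, Au) = λ(g, u)` and `(B(u,u), Au) = 0`, so the
signed shell excess `ξ = ‖∇u‖² - λ‖u‖²_{L²}` obeys `½ξ' = -ν(|Au|² - λ‖∇u‖²) ≤ -νλξ`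
(Tran–Shepherd, Physica D 165 (2002), §4, eq. (ξ) and (constraint); Constantin–Foias–Manley
1994; mean form in Alexakis–Doering, Phys. Lett. A 359 (2006), §4). The tree proves this at the
Galerkin level (`galerkin_shellExcess_le_mul_exp`). This file proves the INTEGRATED form for
every global Leray–Hopf solution on `𝕋²` issued from an `L² ∩ H¹` datum (any momentum):

* `laplacian_eq_smul_of_singleShell` — a smooth single-shell field is a Stokes eigenfunction,
  `Δg = -4π²m g`; `eq_zero_of_singleShell_of_nonpos` — for `m ≤ 0` a mean-zero single-shell
  field vanishes;
* `two_mul_mul_toReal_eGradNormSq_le` — the spectral core `2λ‖∇v‖² ≤ ‖Δv‖² + λ²‖v‖²`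
  (`shellPincer_spectral`) in real form;
* `IsGlobalLerayHopf.energy_eq_two` — the 2-D energy EQUALITY from `t = 0` for an `L²` datum
  (Lions–Prodi; tree: `Torus.WeakNSEnergyClass.energy_eq_zero` + Ladyzhenskaya);
* `singleShell_shellExcess_integral_le` — for `ν > 0`, `m > 0`, datum `u₀ ∈ L² ∩ H¹` weakly
  divergence free and EVERY global Leray–Hopf solution `u`:
  `2νλ ∫₀ᵀ (‖∇u‖² - λ‖u‖²) ≤ ξ(0) - ξ(T) ≤ ‖∇u₀‖² + λ‖u(T)‖²` for every `T > 0` — the enstrophy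
  balance of every Leray–Hopf solution (`fmrt_enstrophy_balance_torus2_holds`, FMRT 2001 Ch. II
  Thm. 7.4, (A.65), via 2-D uniqueness) minus `λ ×` the energy equality, closed by the spectral
  core; `singleShell_setIntegral_enstrophy_le` — hence `∫₀ᵀ‖∇u‖² ≤ λ∫₀ᵀ‖u‖² + C` with `C`
  independent of `T` (uniform `L²` bound of Leray–Hopf solutions, any momentum).

The long-time-mean form `⟨‖∇u‖²⟩ ≤ λ⟨‖u‖²⟩` for all `L²` data is in the sibling
`SingleShellEnstrophyBoundMean`.

## References

* C. V. Tran, T. G. Shepherd, Physica D 165 (2002) 199–212, §4. [`TranShepherd2002`]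
* P. Constantin, C. Foias, O. P. Manley, Phys. Fluids 6 (1994) 427–429.
* A. Alexakis, C. R. Doering, Phys. Lett. A 359 (2006) 652–657, §4. [`AlexakisDoering2006PLA`]
* C. Foias, O. Manley, R. Rosa, R. Temam, *Navier–Stokes Equations and Turbulence*, CUP 2001,
  Ch. II Thm. 7.3–7.4, App. II.A (A.62), (A.65); App. III.A.4 (A.32). [`FoiasManleyRosaTemam2001`]
-/

open MeasureTheory Set Filter Topology UnitAddTorus
open scoped ENNReal NNReal InnerProductSpace

noncomputable section

namespace Literature.Barriers.AnomalousDissipation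

open Literature.Analysis.FunctionSpaces Literature.Analysis.FunctionSpaces.Torus
open Literature.Analysis.FluidPDE Literature.Analysis.FluidPDE.Torus

/-! ### Single-shell fields are Stokes eigenfunctions -/

section Shell

variable {d : Type*} [Fintype d] [DecidableEq d]

/-- A continuous field with Fourier support on the shell `|k|² = m` is band-limited: it is its
own Galerkin truncation at order `⌈m⌉₊` (`|k|² > ⌈m⌉₊² ≥ m` off the ball). [folklore] -/
theorem fourierTruncate_ceil_eq_of_singleShell {g : UnitAddTorus d → EuclideanSpace ℝ d}
    (hg : Continuous g) {m : ℝ}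
    (hshell : ∀ k : d → ℤ, freqNormSq k ≠ m → mFourierCoeff (EuclideanSpace.complexify ∘ g) k = 0) :
    fourierTruncate ⌈m⌉₊ g = g := by
  refine fourierTruncate_eq_self hg fun k hk => hshell k fun hkm => ?_
  have h1 : m ≤ (⌈m⌉₊ : ℝ) := Nat.le_ceil m
  have h2 : (⌈m⌉₊ : ℝ) ≤ (⌈m⌉₊ : ℝ) ^ 2 := by
    rcases Nat.eq_zero_or_pos ⌈m⌉₊ with h0 | hpos
    · simp [h0]
    · have h1' : (1 : ℝ) ≤ ⌈m⌉₊ := by exact_mod_cast hpos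
      nlinarith
  rw [hkm] at hk
  linarith

/-- **A smooth single-shell field is a Stokes eigenfunction**: if the Fourier coefficients of
`g` vanish off the shell `|k|² = m`, then `Δg = -4π²m · g` (`Af = λf`, `λ = 4π²m`; the input
"`(f, Au) = λ(f, u)`" of Tran–Shepherd 2002, §4). [cite: TranShepherd2002, §4 before eq. (ξ)] -/
theorem laplacian_eq_smul_of_singleShell {g : UnitAddTorus d → EuclideanSpace ℝ d}
    (hg : IsSmooth g) {m : ℝ}
    (hshell : ∀ k : d → ℤ, freqNormSq k ≠ m → mFourierCoeff (EuclideanSpace.complexify ∘ g) k = 0) :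
    laplacian g = fun x => (-(4 * Real.pi ^ 2 * m)) • g x := by
  set c : (d → ℤ) → EuclideanSpace ℂ d := fun k => mFourierCoeff (EuclideanSpace.complexify ∘ g) k
    with hc
  have hgt : realTrigPoly (freqBall ⌈m⌉₊) c = g :=
    fourierTruncate_ceil_eq_of_singleShell hg.continuous hshell
  have hcoef : ∀ k ∈ freqBall ⌈m⌉₊,
      -(((4 * Real.pi ^ 2 * freqNormSq k : ℝ) : ℂ) • c k) = ((-(4 * Real.pi ^ 2 * m)) • c) k := by
    intro k _
    rw [Pi.smul_apply, ← Complex.coe_smul, Complex.ofReal_neg, neg_smul]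
    by_cases hk : freqNormSq k = m
    · rw [hk]
    · rw [show c k = 0 from hshell k hk, smul_zero, smul_zero]
  calc laplacian g = laplacian (realTrigPoly (freqBall ⌈m⌉₊) c) := by rw [hgt]
    _ = realTrigPoly (freqBall ⌈m⌉₊) (fun k => -(((4 * Real.pi ^ 2 * freqNormSq k : ℝ) : ℂ) • c k)) :=
        laplacian_realTrigPoly_eq _ _
    _ = realTrigPoly (freqBall ⌈m⌉₊) ((-(4 * Real.pi ^ 2 * m)) • c) := realTrigPoly_congr hcoef
    _ = (-(4 * Real.pi ^ 2 * m)) • realTrigPoly (freqBall ⌈m⌉₊) c := realTrigPoly_smul _ _ _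
    _ = fun x => (-(4 * Real.pi ^ 2 * m)) • g x := by rw [hgt]; rfl

/-- For a level `m ≤ 0` a mean-zero smooth single-shell field vanishes: every non-zero frequency
has `|k|² ≥ 1 > m`, and the mean mode is `∫ g = 0`. [folklore] -/
theorem eq_zero_of_singleShell_of_nonpos {g : UnitAddTorus d → EuclideanSpace ℝ d}
    (hg : IsSmooth g) (hg0 : HasZeroMean g) {m : ℝ} (hm : m ≤ 0)
    (hshell : ∀ k : d → ℤ, freqNormSq k ≠ m → mFourierCoeff (EuclideanSpace.complexify ∘ g) k = 0) :
    g = 0 := by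
  have hcoef : ∀ k : d → ℤ, mFourierCoeff (EuclideanSpace.complexify ∘ g) k = 0 := by
    intro k
    by_cases hk : k = 0
    · subst hk
      have h0 : ∫ x, g x = 0 := hg0
      rw [mFourierCoeff_complexify_zero_eq hg.integrable, h0, map_zero]
    · exact hshell k fun h => by
        have h1 := one_le_freqNormSq_of_ne_zero hk
        linarith
  have h := fourierTruncate_eq_self hg.continuous (N := 0) fun k _ => hcoef k
  rw [← h]
  show realTrigPoly (freqBall 0) (fun k => mFourierCoeff (EuclideanSpace.complexify ∘ g) k) = 0
  rw [realTrigPoly_congr (c' := 0) fun k _ => hcoef k]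
  exact realTrigPoly_zero _

end Shell

/-! ### The spectral core in real form and two pieces of Leray–Hopf bookkeeping -/

section Planar

variable {ν : ℝ} {g u₀ : UnitAddTorus (Fin 2) → EuclideanSpace ℝ (Fin 2)}
  {u : ℝ → UnitAddTorus (Fin 2) → EuclideanSpace ℝ (Fin 2)}

/-- **The spectral core in real form**: for `v ∈ L²(𝕋²)` with `‖Δv‖₂² < ∞` and `Λ ≥ 0`,
`2Λ‖∇v‖₂² ≤ ‖Δv‖₂² + Λ²‖v‖₂²` (termwise `(4π²|k|² - Λ)² ≥ 0`; `shellPincer_spectral` read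
through `eGradNormSq_eq_tsum`, `eLaplacianNormSq_eq_tsum'` and Parseval). [cite: TranShepherd2002, §4 eq. (ξ)] -/
theorem two_mul_mul_toReal_eGradNormSq_le {Λ : ℝ} (hΛ : 0 ≤ Λ) {v : UnitAddTorus (Fin 2) → EuclideanSpace ℝ (Fin 2)}
    (hv : MemLp v 2 volume) (hP : eLaplacianNormSq v ≠ ⊤) :
    2 * Λ * (eGradNormSq v).toReal ≤ (eLaplacianNormSq v).toReal + Λ ^ 2 * ∫ x, ‖v x‖ ^ 2 := by
  classical
  have h := shellPincer_spectral Λ hΛ v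
  have h1 : ∑' k : Fin 2 → ℤ, ENNReal.ofReal (4 * Real.pi ^ 2 * freqNormSq k) *
      ‖mFourierCoeff (EuclideanSpace.complexify ∘ v) k‖ₑ ^ 2 = eGradNormSq v := by
    rw [eGradNormSq_eq_tsum, ← ENNReal.tsum_mul_left]
    refine tsum_congr fun k => ?_
    rw [ENNReal.ofReal_mul (by positivity), mul_assoc]
  have h2 : ∑' k : Fin 2 → ℤ, ENNReal.ofReal ((4 * Real.pi ^ 2 * freqNormSq k) ^ 2) *
      ‖mFourierCoeff (EuclideanSpace.complexify ∘ v) k‖ₑ ^ 2 = eLaplacianNormSq v := by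
    rw [eLaplacianNormSq_eq_tsum', ← ENNReal.tsum_mul_left]
    refine tsum_congr fun k => ?_
    rw [Real.rpow_two,
      show (4 * Real.pi ^ 2 * freqNormSq k) ^ 2 = 16 * Real.pi ^ 4 * freqNormSq k ^ 2 by ring,
      ENNReal.ofReal_mul (by positivity), mul_assoc]
  have h3 : ∑' k : Fin 2 → ℤ, ‖mFourierCoeff (EuclideanSpace.complexify ∘ v) k‖ₑ ^ 2 =
      ENNReal.ofReal (∫ x, ‖v x‖ ^ 2) := by
    rw [tsum_enorm_sq_mFourierCoeff_complexify hv, Torus.lintegral_enorm_sq_eq_ofReal hv]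
  rw [h1, h2, h3] at h
  have hE : ENNReal.ofReal (Λ ^ 2) * ENNReal.ofReal (∫ x, ‖v x‖ ^ 2) ≠ ⊤ :=
    ENNReal.mul_ne_top ENNReal.ofReal_ne_top ENNReal.ofReal_ne_top
  have hfin : eLaplacianNormSq v + ENNReal.ofReal (Λ ^ 2) * ENNReal.ofReal (∫ x, ‖v x‖ ^ 2) ≠ ⊤ :=
    ENNReal.add_ne_top.2 ⟨hP, hE⟩
  have h' := ENNReal.toReal_mono hfin h
  rwa [ENNReal.toReal_mul, ENNReal.toReal_mul, ENNReal.toReal_ofNat, ENNReal.toReal_ofReal hΛ,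
    ENNReal.toReal_add hP hE, ENNReal.toReal_mul, ENNReal.toReal_ofReal (sq_nonneg _),
    ENNReal.toReal_ofReal (integral_nonneg fun _ => sq_nonneg _)] at h'

/-- A steady `L²` field, lifted to space–time, is in the guarded mixed class `L¹(0,T; L²)`. [folklore] -/
theorem memLqLp_one_two_steady {d : Type*} [Fintype d] {F : UnitAddTorus d → EuclideanSpace ℝ d}
    (hF : MemLp F 2 volume) (T : ℝ) : Torus.MemLqLp 1 2 (fun _ : ℝ => F) (Ioo 0 T) := by
  -- adapted from Summits/.../WazewskiBlockEnstrophyCapNoLeakageEnergy.lean (`memLqLp_one_two_const`)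
  haveI : IsFiniteMeasure (volume.restrict (Ioo (0 : ℝ) T)) :=
    ⟨by rw [Measure.restrict_apply_univ]; exact measure_Ioo_lt_top⟩
  exact ⟨ae_of_all _ fun _ => hF, (memLp_const (eLpNorm F 2 volume).toReal).2⟩

/-- **The two-dimensional energy EQUALITY from `t = 0`** (Lions–Prodi 1959; FMRT 2001, Ch. II
Thm. 7.3): a global Leray–Hopf solution on `𝕋²` with steady smooth force and datum `u₀ ∈ L²`
satisfies `½‖u(t)‖² + ν∫₀ᵗ‖∇u‖² = ½‖u₀‖² + ∫₀ᵗ(g, u)` for every `t > 0` — `u ∈ L⁴ₜL⁴ₓ` by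
Ladyzhenskaya (`IsLerayHopfOn.lintegral_lintegral_enorm_pow_four_lt_top`) and
`Torus.WeakNSEnergyClass.energy_eq_zero`. [cite: FoiasManleyRosaTemam2001, Ch. II Thm. 7.3] -/
theorem IsGlobalLerayHopf.energy_eq_two (hν : 0 ≤ ν) (hg : IsSmooth g) (hu₀ : MemLp u₀ 2 volume)
    (hu : IsGlobalLerayHopf ν (fun _ => g) u₀ u) {t : ℝ} (ht : 0 < t) :
    kineticEnergy (u t) + ν * (∫⁻ τ in Ioo 0 t, eGradNormSq (u τ)).toReal =
      kineticEnergy u₀ + ∫ τ in (0 : ℝ)..t, ∫ x, ⟪g x, u τ x⟫_ℝ := by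
  have hLH := hu t ht
  have hfm : AEStronglyMeasurable (stLift (fun _ : ℝ => g)) (volume.restrict (Ioo 0 t ×ˢ univ)) :=
    aestronglyMeasurable_stLift_const hg _
  have hL4 := hLH.lintegral_lintegral_enorm_pow_four_lt_top hν hfm (lintegral_enorm_sq_const_lt_top hg t)
  exact WeakNSEnergyClass.energy_eq_zero (by simp) (by simp) hLH.weak hLH.energy_bound hLH.memLp
    hLH.memL2Sobolev hLH.weak_continuous hu₀ hL4 hfm (memLqLp_one_two_steady (hg.memLp 2) t) t
    ⟨ht, le_rfl⟩

/-! ### The integrated dynamical constraint for `L² ∩ H¹` data -/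

/-- **Tran–Shepherd's dynamical constraint, integrated, for every Leray–Hopf solution from an
`L² ∩ H¹` datum** (Tran–Shepherd 2002, §4, eq. (ξ): `½ξ' = -ν(|Au|² - λ‖u‖²) ≤ -νλξ`,
`ξ = ‖∇u‖² - λ‖u‖²_{L²}`; FMRT 2001 App. III.A.4 (A.32) for the first shell). On `𝕋²`, for
`ν > 0`, a smooth divergence-free mean-zero steady force `g` with Fourier support on the shell
`|k|² = m`, `m > 0`, `λ = 4π²m`, a datum `u₀ ∈ L²` of finite enstrophy, weakly divergence free,
and EVERY global Leray–Hopf solution `u`: for every `T > 0`,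
`2νλ(∫₀ᵀ‖∇u‖² - λ∫₀ᵀ‖u‖²) ≤ (‖∇u₀‖² - λ‖u₀‖²) - (‖∇u(T)‖² - λ‖u(T)‖²)`. Proof: the enstrophy
balance `½‖∇u(T)‖² + ν∫₀ᵀ‖Δu‖² = ½‖∇u₀‖² - ∫₀ᵀ(Δg, u)` of every Leray–Hopf solution
(`fmrt_enstrophy_balance_torus2_holds`; `(Δg, u) = -λ(g, u)` by
`laplacian_eq_smul_of_singleShell`) minus `λ ×` the energy equality
(`IsGlobalLerayHopf.energy_eq_two`), and `‖Δu‖² ≥ 2λ‖∇u‖² - λ²‖u‖²` a.e. in time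
(`two_mul_mul_toReal_eGradNormSq_le`). Any momentum is allowed. [cite: TranShepherd2002, §4 eq. (ξ) and (constraint)] -/
theorem singleShell_shellExcess_integral_le (hν : 0 < ν) (hg : IsSmooth g) (hgd : IsDivFree g)
    (hg0 : HasZeroMean g) {m : ℝ} (hm : 0 < m)
    (hshell : ∀ k : Fin 2 → ℤ, freqNormSq k ≠ m → mFourierCoeff (EuclideanSpace.complexify ∘ g) k = 0)
    (hu₀ : MemLp u₀ 2 volume) (hG : eGradNormSq u₀ ≠ ⊤) (hdiv : IsWeaklyDivFree u₀)
    (hu : IsGlobalLerayHopf ν (fun _ => g) u₀ u) {T : ℝ} (hT : 0 < T) :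
    2 * ν * (4 * Real.pi ^ 2 * m) *
        ((∫ t in Ioc 0 T, (eGradNormSq (u t)).toReal) -
          4 * Real.pi ^ 2 * m * ∫ t in Ioc 0 T, ∫ x, ‖u t x‖ ^ 2) ≤
      ((eGradNormSq u₀).toReal - 4 * Real.pi ^ 2 * m * ∫ x, ‖u₀ x‖ ^ 2) -
        ((eGradNormSq (u T)).toReal - 4 * Real.pi ^ 2 * m * ∫ x, ‖u T x‖ ^ 2) := by
  set lam : ℝ := 4 * Real.pi ^ 2 * m with hlam
  have hlam0 : 0 < lam := by positivity
  have hLH := hu T hT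
  -- the enstrophy balance of every Leray–Hopf solution (2-D uniqueness inside)
  obtain ⟨hH2, hbal⟩ := fmrt_enstrophy_balance_torus2_holds hν hg hgd hg0
    (memSobolev_one_complexify_of_eGradNormSq_ne_top hu₀ hG) hdiv hu
  have hb := hbal T hT
  -- the force is a Stokes eigenfunction: `(Δg, u) = -λ (g, u)`
  have hlap : ∀ s, (∫ x, ⟪laplacian g x, u s x⟫_ℝ) = -lam * ∫ x, ⟪g x, u s x⟫_ℝ := by
    intro s
    rw [laplacian_eq_smul_of_singleShell hg hshell, ← integral_const_mul]
    exact integral_congr_ae (ae_of_all _ fun x => real_inner_smul_left _ _ _)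
  simp_rw [hlap] at hb
  rw [integral_const_mul] at hb
  -- the energy equality
  have he := IsGlobalLerayHopf.energy_eq_two hν.le hg hu₀ hu hT
  rw [kineticEnergy, kineticEnergy, ← (hu.integrableOn_toReal_eGradNormSq hT).2,
    intervalIntegral.integral_of_le hT.le] at he
  -- the spectral core, a.e. in time, integrated
  have hZi := (hu.integrableOn_toReal_eGradNormSq hT).1
  have hPi := hLH.integrableOn_toReal_eLaplacianNormSq (hH2 T hT)
  have hEi := hu.integrableOn_integral_norm_sq hT
  have hae : ∀ᵐ s ∂(volume.restrict (Ioc 0 T)), 2 * lam * (eGradNormSq (u s)).toReal ≤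
      (eLaplacianNormSq (u s)).toReal + lam ^ 2 * ∫ x, ‖u s x‖ ^ 2 := by
    rw [← Measure.restrict_congr_set Ioo_ae_eq_Ioc]
    filter_upwards [hLH.ae_eLaplacianNormSq_lt_top (hH2 T hT), ae_restrict_mem measurableSet_Ioo]
      with s hs hsI
    exact two_mul_mul_toReal_eGradNormSq_le hlam0.le (hu.memLp_two hsI.1.le) hs.ne
  have hs : 2 * lam * ∫ t in Ioc 0 T, (eGradNormSq (u t)).toReal ≤
      (∫ t in Ioc 0 T, (eLaplacianNormSq (u t)).toReal) + lam ^ 2 * ∫ t in Ioc 0 T, ∫ x, ‖u t x‖ ^ 2 := by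
    rw [← integral_const_mul, ← integral_const_mul, ← integral_add hPi (hEi.const_mul _)]
    exact integral_mono_ae (hZi.const_mul _) (hPi.add (hEi.const_mul _)) hae
  have hs' := mul_le_mul_of_nonneg_left hs hν.le
  have he' : lam * (2⁻¹ * (∫ x, ‖u T x‖ ^ 2) + ν * ∫ t in Ioc 0 T, (eGradNormSq (u t)).toReal) =
      lam * (2⁻¹ * (∫ x, ‖u₀ x‖ ^ 2) + ∫ t in Ioc 0 T, ∫ x, ⟪g x, u t x⟫_ℝ) := by rw [he]
  nlinarith [hb, he', hs']

/-- **The enstrophy is slaved below `λ ×` the energy in time integral, `L² ∩ H¹` data**: under the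
hypotheses of `singleShell_shellExcess_integral_le` there is `C` (depending on the solution but
not on `T`) with `∫₀ᵀ‖∇u‖² ≤ 4π²m ∫₀ᵀ‖u‖²_{L²} + C` for every `T > 0`
(`C = (‖∇u₀‖² + λ sup_t‖u(t)‖²)/(2νλ)`, the uniform `L²` bound of Leray–Hopf solutions with a
mean-zero force, any momentum, `IsGlobalLerayHopf.exists_forall_integral_norm_sq_le_of_hasZeroMean`).
This is Tran–Shepherd's constraint `‖u‖₁² ≤ λ_s‖u‖²` up to a transient of finite time integral. [cite: TranShepherd2002, §4 (constraint)] -/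
theorem singleShell_setIntegral_enstrophy_le (hν : 0 < ν) (hg : IsSmooth g) (hgd : IsDivFree g)
    (hg0 : HasZeroMean g) {m : ℝ} (hm : 0 < m)
    (hshell : ∀ k : Fin 2 → ℤ, freqNormSq k ≠ m → mFourierCoeff (EuclideanSpace.complexify ∘ g) k = 0)
    (hu₀ : MemLp u₀ 2 volume) (hG : eGradNormSq u₀ ≠ ⊤) (hdiv : IsWeaklyDivFree u₀)
    (hu : IsGlobalLerayHopf ν (fun _ => g) u₀ u) :
    ∃ C : ℝ, ∀ T, 0 < T →
      ∫ t in Ioc 0 T, (eGradNormSq (u t)).toReal ≤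
        4 * Real.pi ^ 2 * m * (∫ t in Ioc 0 T, ∫ x, ‖u t x‖ ^ 2) + C := by
  obtain ⟨R, hR⟩ := hu.exists_forall_integral_norm_sq_le_of_hasZeroMean hν (hg.memLp 2) hg0
  set lam : ℝ := 4 * Real.pi ^ 2 * m with hlam
  have hlam0 : 0 < lam := by positivity
  refine ⟨((eGradNormSq u₀).toReal + lam * R) / (2 * ν * lam), fun T hT => ?_⟩
  have h := singleShell_shellExcess_integral_le hν hg hgd hg0 hm hshell hu₀ hG hdiv hu hT
  have hRT := hR T hT.le
  have hE0 : 0 ≤ ∫ x, ‖u₀ x‖ ^ 2 := integral_nonneg fun _ => sq_nonneg _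
  have hZT : 0 ≤ (eGradNormSq (u T)).toReal := ENNReal.toReal_nonneg
  have hc : 0 < 2 * ν * lam := by positivity
  rw [← sub_le_iff_le_add', le_div_iff₀ hc]
  nlinarith [mul_nonneg hlam0.le hE0, mul_le_mul_of_nonneg_left hRT hlam0.le]

end Planar

end Literature.Barriers.AnomalousDissipation

end
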